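import Literature.AlgebraicGeometry.Frobenioids.PadicKummerRemark221General
import Literature.AlgebraicGeometry.Frobenioids.PadicKummerThm24iFieldIso
import HarnessLib

/-!
# Frobenioids II, Def. 2.3 / Thm. 2.4 (i) at EVERY saturated arithmetic object (consumers of Rmk. 2.2.1, general `N`)

Mochizuki, *The geometry of Frobenioids II*, Kyushu J. Math. **62** (2008) 401–460, §2, Definition 2.3
p. 19 and Theorem 2.4 (i) pp. 19–20 [cite: MochizukiFrdII2008, Def 2.3 p.19]: "the reciprocity map
`O^□(A)^H → H_A^ab ⊗ F_N(A)` … [associated to the `(N,H)`-saturated object `A`]"; "compatible with the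
respective Kummer and reciprocity maps".

PROOF-ONLY companion (abc-iut cell, seat abc-iut-E-t32 g8; sequel «GAP-2R CONSUMERS» of
`PadicKummerRemark221General.lean`).  The Definition 2.3 / Theorem 2.4 (i) closers at the arithmetic
context `Def22Context.ofLocalField` (`reciprocityMapOfLocalField` in `PadicKummerDualityIsoLocalField.lean`,
`Iso.recTargetMap_reciprocityMapOfLocalField` in `PadicKummerThm24iFieldIso.lean`) carry the root-existence observation of Remark 2.2.1,
"any `f ∈ O^□(A)^H` admits an `N`-th root" (`Kummer.InvariantsAdmitRoots`), as an explicit binder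
`hR`, discharged so far only when `Gal(K̄/L) ≤ H` — i.e. COFINALLY in `L`
(`exists_dualityIso_hypotheses_ofLocalField`).  With Remark 2.2.1 now proved for general `N`
(`saturatedInvariantsAdmitRoots_ofLocalField_box_general`), the binder is discharged at EVERY
`(N, H)`-saturated arithmetic `A = (L, O^□_L)` over a non-archimedean local field of characteristic `0`:
* `invariantsAdmitRoots_ofLocalField_box` — `hR` from saturation alone;
* `dualityIso_hypotheses_ofLocalField_box` — all standing inputs of Def. 2.3 (`hS`, `hR`,
  `NthRootsDifferByUnits`, `F_N(A) ≅ ℤ/Nℤ`) at every saturated `A`, no passage to a larger `L`;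
* `Iso.recTargetMap_reciprocityMapOfLocalField_box` — **Theorem 2.4 (i), reciprocity-map
  compatibility between two saturated arithmetic objects, with NO residual input** (the `hRᵢ` of
  `Iso.recTargetMap_reciprocityMapOfLocalField` discharged).
HONEST SCOPE: OUR kernel checks of typed instance forms; nothing concerns [IUTchIII]; no side taken on
Cor. 3.12. Universe `0`.
-/

noncomputable section

namespace Literature.AlgebraicGeometry.Frobenioids

namespace PadicKummer

namespace Def22Context

open Field IntermediateField Kummer
open scoped ValuativeRel
open Literature.NumberTheory.GaloisRepresentations

section OneObject

variable (K : Type) [Field K] [ValuativeRel K] [TopologicalSpace K] [IsNonarchimedeanLocalField K]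
  [CharZero K] (L : IntermediateField K (AlgebraicClosure K)) [FiniteDimensional K L] [Normal K L]
  (H : Subgroup (absoluteGaloisGroup K)) [H.Normal] (hH : IsOpen (H : Set (absoluteGaloisGroup K)))
  (fs : Prop) (N : ℕ) [NeZero N]

/-- **Remark 2.2.1 ⇒ the input `hR` of Definition 2.3**: at every `(N, H)`-saturated arithmetic
`A = (L, O^□_L)` over a non-archimedean local field of characteristic `0`, every `H_A`-invariant of
`O^□(A)` admits an `N`-th root in `O^□(A)`. [cite: MochizukiFrdII2008, Rmk 2.2.1 p.18] -/
theorem invariantsAdmitRoots_ofLocalField_box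
    (h : IsNHSaturated (ofLocalField L H hH (boxStableSubmonoid K L fs)) N) :
    InvariantsAdmitRoots N (GalMonoid (boxStableSubmonoid K L fs))
      (ofLocalField L H hH (boxStableSubmonoid K L fs)).HA :=
  saturatedInvariantsAdmitRoots_ofLocalField_box_general K L H hH N fs h

/-- **The standing inputs of Definition 2.3 hold at EVERY saturated arithmetic object** (no
`Gal(K̄/L) ≤ H`, no enlargement of `L` — compare the cofinal form
`exists_dualityIso_hypotheses_ofLocalField`): `O^□_L ∋` the `N`-th roots of unity of `L`, every
`f ∈ O^□(A)^H` has an `N`-th root, `N`-th roots differ by units, and `F_N(A) ≅ ℤ/Nℤ`.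
[cite: MochizukiFrdII2008, Def 2.3 p.19] -/
theorem dualityIso_hypotheses_ofLocalField_box
    (h : IsNHSaturated (ofLocalField L H hH (boxStableSubmonoid K L fs)) N) :
    (∀ x : L, x ^ N = 1 → x ∈ (boxStableSubmonoid K L fs).toSubmonoid) ∧
      InvariantsAdmitRoots N (GalMonoid (boxStableSubmonoid K L fs))
        (ofLocalField L H hH (boxStableSubmonoid K L fs)).HA ∧
      NthRootsDifferByUnits N (GalMonoid (boxStableSubmonoid K L fs)) ∧
      Nonempty (FN (ofLocalField L H hH (boxStableSubmonoid K L fs)) N ≃+ ZMod N) := by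
  have hS : ∀ x : L, x ^ N = 1 → x ∈ (boxStableSubmonoid K L fs).toSubmonoid := fun x hx =>
    mem_boxStableSubmonoid_of_pow_eq_one K L N fs (NeZero.pos N) hx
  have hμ := coe_rootsOfUnity_mem_of_isMuSaturated L (boxStableSubmonoid K L fs) N h.muSaturated
  exact ⟨hS, invariantsAdmitRoots_ofLocalField_box K L H hH fs N h,
    GalMonoid.nthRootsDifferByUnits (boxStableSubmonoid K L fs) N hS,
    nonempty_fn_equiv_zmod_ofLocalField L H hH (boxStableSubmonoid K L fs) N hS hμ h⟩

end OneObject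

namespace Iso

section TwoObjects

variable {K₁ : Type} [Field K₁] [ValuativeRel K₁] [TopologicalSpace K₁]
  [IsNonarchimedeanLocalField K₁] [CharZero K₁]
  {K₂ : Type} [Field K₂] [ValuativeRel K₂] [TopologicalSpace K₂]
  [IsNonarchimedeanLocalField K₂] [CharZero K₂]
  {L₁ : IntermediateField K₁ (AlgebraicClosure K₁)} [Normal K₁ L₁] [FiniteDimensional K₁ L₁]
  {H₁ : Subgroup (absoluteGaloisGroup K₁)} [H₁.Normal] {hH₁ : IsOpen (H₁ : Set (absoluteGaloisGroup K₁))}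
  {fs₁ : Prop}
  {L₂ : IntermediateField K₂ (AlgebraicClosure K₂)} [Normal K₂ L₂] [FiniteDimensional K₂ L₂]
  {H₂ : Subgroup (absoluteGaloisGroup K₂)} [H₂.Normal] {hH₂ : IsOpen (H₂ : Set (absoluteGaloisGroup K₂))}
  {fs₂ : Prop}
  (f : Iso (Def22Context.ofLocalField L₁ H₁ hH₁ (boxStableSubmonoid K₁ L₁ fs₁))
    (Def22Context.ofLocalField L₂ H₂ hH₂ (boxStableSubmonoid K₂ L₂ fs₂)))
  (N : ℕ) [NeZero N]

/-- **Theorem 2.4 (i), reciprocity-map compatibility between two `(N, Hᵢ)`-saturated arithmetic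
objects, NO residual input** ("induces isomorphisms … compatible with the respective … reciprocity
maps"): along every isomorphism of the two local-field contexts with `O^□` as in Def. 2.2 (iii), the
Definition 2.3 reciprocity maps (with the constructed duality isomorphisms and the root-existence of
Remark 2.2.1 now PROVED, `invariantsAdmitRoots_ofLocalField_box`) correspond under `isoInvariants`
and `isoHA^ab ⊗ isoFN`. [cite: MochizukiFrdII2008, Thm 2.4 (i) p.19] -/
theorem recTargetMap_reciprocityMapOfLocalField_box
    (h₁ : IsNHSaturated (Def22Context.ofLocalField L₁ H₁ hH₁ (boxStableSubmonoid K₁ L₁ fs₁)) N)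
    (h₂ : IsNHSaturated (Def22Context.ofLocalField L₂ H₂ hH₂ (boxStableSubmonoid K₂ L₂ fs₂)) N)
    (x : invariantsSubmonoid (Def22Context.ofLocalField L₁ H₁ hH₁ (boxStableSubmonoid K₁ L₁ fs₁)).O
      (Def22Context.ofLocalField L₁ H₁ hH₁ (boxStableSubmonoid K₁ L₁ fs₁)).HA) :
    (f.thm24Data N).recTargetMap (Multiplicative.toAdd
        (reciprocityMapOfLocalField L₁ H₁ hH₁ (boxStableSubmonoid K₁ L₁ fs₁) N
          (fun _ hx => mem_boxStableSubmonoid_of_pow_eq_one K₁ L₁ N fs₁ (NeZero.pos N) hx) h₁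
          (invariantsAdmitRoots_ofLocalField_box K₁ L₁ H₁ hH₁ fs₁ N h₁) x)) =
      Multiplicative.toAdd
        (reciprocityMapOfLocalField L₂ H₂ hH₂ (boxStableSubmonoid K₂ L₂ fs₂) N
          (fun _ hx => mem_boxStableSubmonoid_of_pow_eq_one K₂ L₂ N fs₂ (NeZero.pos N) hx) h₂
          (invariantsAdmitRoots_ofLocalField_box K₂ L₂ H₂ hH₂ fs₂ N h₂) (f.isoInvariants x)) :=
  f.recTargetMap_reciprocityMapOfLocalField N _ h₁ _ _ h₂ _ x

end TwoObjects

end Iso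

end Def22Context

end PadicKummer

end Literature.AlgebraicGeometry.Frobenioids

end
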